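import Summits.QuantumFields.BalabanUV.T4Continuum.Spine.NE9.CarriersOfRecordFacesTR
import Summits.QuantumFields.BalabanUV.T4Continuum.Support.NE9TorusSizeDichotomy

/-!
# NE9RecordIneq126Above — [II] (1.26) ABOVE ITS THRESHOLD ON THE CARRIERS OF RECORD (`2²⁰ + K₀(64,8)·e^{−(κ−κ₀)}` in place of
# `K₀(64,8) = 162⁶⁴/81 ∈ (10¹³⁹, 10¹⁴⁰)`), and the A1-KP producer of the NE9 carriers-of-record face re-instantiated with THIS constant
# (cell `pub-balaban`, T4-DAG §2 node U3 / §6 rows NE9 ∕ NE5; NE9 formalisation swarm LEAF PROVER 05, lineage leaf-05, generation 3; part 2 of 2)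

HONEST FRAMING (T4-DAG PAGE 1).  Rung (B)+1 of the FINITE-VOLUME T⁴ programme — existence AND uniqueness of the ε → 0 limit of
gauge-invariant observables on a fixed torus; NOT infinite volume, NOT a mass gap, NOT the Clay problem.  NE9 (`T4OutputRate.NE9` ∧
`FadingMemory`) is a cell NEW ESTIMATE, NOT PRINTED, and is NOT discharged here («NE9 ⇐ the named binders»); spine 0/9 unchanged; 0/18
leaves instantiated on Bałaban's objects.  HONEST DEPENDENCY (cell line, verbatim): continuum YM on T⁴ ⇐ BetaPertH ∧ nine spine estimates
(0/9 proved); BetaPertH ⇐ (D1) ∧ (D4) ∧ CAP+tail; G-an2-4 gates asym, D1 and NE2/3/4.  `FlowStep.BetaPertH`, (B), (B^μ) do not occur here.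
[II] = [Balaban1988RG2Cluster] is quoted for TYPES only (ABSOLUTE RULE: nothing printed in the audited series is asserted).

THE LOCATED POINT (census class; numbers, not adjectives).  On the NE9 carriers-of-record face (`Spine/NE9/CarriersOfRecordFacesTR`,
p211088) the A1-KP conjunct is produced in the PRINTED currency `d_j = torusTreeLen` by NE5-P2's `B13DomainGeometryTR.kpInflated_b13` through
`CarriersOfRecordFacesTR.twoPointKP_of_kpInflated` (cross-read C-ne9leaf09g4-2 (Q4)).  That producer evaluates [II] (1.26) AT ITS THRESHOLD
`κ₀ = 64·log 162` with the constant `K₀(64, 8) = e^{κ₀}/81 = 162⁶⁴/81 ∈ (10¹³⁹, 10¹⁴⁰)` (§2, kernel), so its smallness clause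
`(1+s)·A·e^{5σ+64τ}·K₀(64,8)·9 ≤ τ` asks the displayed (2.38)-amplitude `A` for `A ≤ τ·e^{−5σ−64τ}/((1+s)·9·K₀) < 10⁻¹³⁹·τ`
(C-ne9leaf09g4-2 INFO 1: *"σ alone cannot shrink the envelope"*).  Print's own cure is its remark after (1.26), p. 8 l. 11–13, verbatim:
*"The number O(1) is in fact small, because we sum over X with d_j(X) ≠ 0, as it follows from our inductive construction."* — made
quantitative on the cell's model in part 1 (`NE9TorusSizeDichotomy`: torus dichotomy, the `d = 0` class count, (1.26) above threshold).
THIS FILE (kernel, no new definition, no `def … : Prop`):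
* §1 **on the carriers of record** `B13Carriers.TwoRuns.carriers`: the `d = 0` class through a sigma cube has ≤ `2²⁰` members at every scale,
  hence `Ineq126 (R.domAt k) footprint d κ (2²⁰ + K₀(64,8)·e^{−(κ − 64·log 162)})` for `κ ≥ 64·log 162`, and the remark's form;
* §2 the numerals: `K₀(64,8) = 162⁶⁴/81`, `10¹³⁹ < K₀(64,8) < 10¹⁴⁰`, `64·log 162 < 326`; at `κ = 128·log 162` the constant is `2²⁰ + 1/81`;
* §3 **the re-instantiated producer** `kpInflated_b13_above` = `ClusterRepKP.kpInflated_of_majorant` fed with §1: rate room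
  `(64·log 162 + s′) + σ + 64τ ≤ R`, smallness `(1+s)·A·e^{5σ+64τ}·(2²⁰ + K₀(64,8)·e^{−s′})·9 ≤ τ` (at `s′ = 64·log 162` the constant is
  `2²⁰ + 1/81 < 1.05·10⁶`);
* §4 the A1-KP conjunct of the NE9 END on the carriers of record from it, BY NAME through `twoPointKP_of_kpInflated` (leaf-05-g2).
Nothing of `B13DomainGeometryTR` (t4-ne5-p2) or of `CarriersOfRecordFacesTR` (leaf-05-g2) is modified; both are consumed BY NAME; the threshold
producer `kpInflated_b13` stays as it is (this is a sibling, not a replacement).  DISGUISE TEST: geometry and real arithmetic about ONE run's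
domain catalogue plus a re-instantiation; the (2.38)-shaped majorant stays a DISPLAYED hypothesis shape (NODE O's); no history — not NE9, not NE5.

References (TYPES only): T. Bałaban, *Renormalization group approach to lattice gauge field theories. II. Cluster expansions*, Commun.
Math. Phys. **116**, 1–22 (1988) [Balaban1988RG2Cluster], (1.26) p. 8 (remark l. 11–13), Lemma 3 (2.38) p. 20 (shape only; render
`b2b-balaban-ref1/pages/1988-cmp116-rg-II-cluster/1988-cmp116-rg-II-cluster-p008-x2.png` re-read as an image by this seat, 2026-08-20).
Summits-side NEW work (LEAN PLACEMENT RULE); imports `Spine.NE9.CarriersOfRecordFacesTR` and part 1 only; 0 sorry.  Value = kernel bookkeeping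
(a producer's constant brought from `10^{139.6}` to `2²⁰ + 1/81` by a theorem of the cell's geometry), NOT summit progress.
-/

noncomputable section

open scoped BigOperators

namespace Summit.QuantumFields.BalabanUV.T4Continuum.NE9RecordIneq126Above

open Literature.MathematicalPhysics.QuantumFieldTheory.Balaban1983to89
open Literature.MathematicalPhysics.QuantumFieldTheory.Balaban1983to89.TreeLengthTorus
open Literature.MathematicalPhysics.QuantumFieldTheory.Balaban1983to89.B13FamilySum (Ineq126)
open Literature.MathematicalPhysics.QuantumFieldTheory.Balaban1983to89.B12TreeDecay (K₀ kappa₀ a₀ K₀_pos)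
open Literature.MathematicalPhysics.QuantumFieldTheory.Balaban1983to89.T4ActivityRecursion (KPInflated)
open Literature.MathematicalPhysics.QuantumFieldTheory.Balaban1983to89.T4HistoryLipschitzActivity
open Literature.MathematicalPhysics.QuantumFieldTheory.Balaban1983to89.T4HistoryLipschitzActivity (ClusterGeom)
open Literature.MathematicalPhysics.QuantumFieldTheory.Balaban1983to89.T4HistoryLipschitzSegment (TwoPointKP)
open Summit.QuantumFields.BalabanUV.T4Continuum.B13Carriers (TwoRuns)
open Summit.QuantumFields.BalabanUV.T4Continuum.B13DomainGeometryTR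
open Summit.QuantumFields.BalabanUV.T4Continuum.ClusterRepKP (kpInflated_of_majorant)
open Summit.QuantumFields.BalabanUV.T4Continuum.NE9.CarriersOfRecordFacesTR (twoPointKP_of_kpInflated)
open Summit.QuantumFields.BalabanUV.T4Continuum.NE9TorusSizeDichotomy
  (torusTreeLen_dichotomy card_filter_torusTreeLen_eq_zero_le ineq126_above sum_filter_ne_zero_le)

/-! ## §1 (1.26) above its threshold ON THE CARRIERS OF RECORD -/

section Record

variable {G : Type} [GaugeGroup G] (R : TwoRuns G)

/-- On the carriers of record, at every scale `k` and for every sigma cube `c`, at most `2⁴·2¹⁶ = 2²⁰` catalogued domains through `c`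
have linear size `0` (part 1 §2 transported along `domEmb`). [folklore] -/
theorem card_filter_d_eq_zero_le_record (k : ℕ) (c : SCube R) :
    (((R.domAt k).filter fun Y => c ∈ footprint Y).filter fun Y => R.carriers.d Y = 0).card ≤ 2 ^ 20 := by
  classical
  obtain ⟨j, q⟩ := c
  by_cases hjk : j = k
  · subst hjk
    -- pull back to the torus domains of scale `j`, then forget the subtype
    have hDsub : (((R.domAt j).filter fun Y => (⟨j, q⟩ : SCube R) ∈ footprint Y).filter
        fun Y => R.carriers.d Y = 0) ⊆ R.domAt j :=
      (Finset.filter_subset _ _).trans (Finset.filter_subset _ _)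
    have hDeq := eq_map_pullback hDsub
    rw [hDeq, Finset.card_map]
    have hSdom : ∀ Y ∈ (Finset.univ : Finset (TDom 4 (R.cubesPerDir j))).image Subtype.val,
        Y.Nonempty ∧ TFaceConnected Y := by
      intro Y hY
      obtain ⟨Z, -, rfl⟩ := Finset.mem_image.1 hY
      exact Z.2
    have hcount := card_filter_torusTreeLen_eq_zero_le
      ((Finset.univ : Finset (TDom 4 (R.cubesPerDir j))).image Subtype.val) hSdom q
    refine le_trans ?_ (hcount.trans (by norm_num))
    refine Finset.card_le_card_of_injOn Subtype.val ?_ (Set.injOn_of_injective Subtype.val_injective)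
    intro Z hZ
    have hZD := (Finset.mem_filter.1 (Finset.mem_coe.1 hZ)).2
    have h1 := Finset.mem_filter.1 hZD
    have h2 := Finset.mem_filter.1 h1.1
    have hZu : Z ∈ (Finset.univ : Finset (TDom 4 (R.cubesPerDir j))) := Finset.mem_univ Z
    refine Finset.mem_coe.2 (Finset.mem_filter.2 ⟨Finset.mem_image_of_mem Subtype.val hZu, ?_, ?_⟩)
    · exact mk_mem_footprint_iff.1 h2.2
    · exact h1.2
  · -- a cube of another scale lies in no footprint of scale `k`
    have hempty : ((R.domAt k).filter fun Y => (⟨j, q⟩ : SCube R) ∈ footprint Y) = ∅ := by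
      refine Finset.filter_false_of_mem fun Y hY hcY => hjk ?_
      rw [domAt_eq_map, Finset.mem_map] at hY
      obtain ⟨Z, -, rfl⟩ := hY
      exact fst_eq_of_mem_footprint hcY
    rw [hempty, Finset.filter_empty, Finset.card_empty]
    exact Nat.zero_le _

/-- **[II] (1.26) ABOVE ITS THRESHOLD ON THE CARRIERS OF RECORD** (every scale, every cube): for `κ ≥ κ₀ = 64·log 162`,
`Σ_{Y ∈ 𝐃_k, Y ∋ c} e^{−κ d(Y)} ≤ 2²⁰ + K₀(64, 8)·e^{−(κ − κ₀)}` — the threshold form `B13DomainGeometryTR.ineq126_level` (constant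
`K₀(64,8) = 162⁶⁴/81`, §2) improved by the dichotomy and the count of the `d = 0` class (part 1). [cite: Balaban1988RG2Cluster, (1.26) p.8] -/
theorem ineq126_level_above (k : ℕ) {κ : ℝ} (hκ : 64 * Real.log 162 ≤ κ) :
    Ineq126 (R.domAt k) (fun X => footprint X) R.carriers.d κ
      (2 ^ 20 + K₀ (4 * 2 ^ 4) (2 * 4) * Real.exp (-(κ - 64 * Real.log 162))) :=
  ineq126_above (ineq126_level (R := R) k) (fun Y _ => torusTreeLen_dichotomy Y.2.1)
    (fun c => by exact_mod_cast card_filter_d_eq_zero_le_record R k c) hκ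

/-- The remark's form on the carriers of record: for `κ ≥ 64·log 162`, the part of the (1.26)-sum over the domains with `d ≠ 0` is at most
`K₀(64,8)·e^{−(κ − 64·log 162)}`. [cite: Balaban1988RG2Cluster, (1.26) p.8] -/
theorem sum_filter_d_ne_zero_le_record (k : ℕ) {κ : ℝ} (hκ : 64 * Real.log 162 ≤ κ) (c : SCube R) :
    ∑ Y ∈ ((R.domAt k).filter fun Y => c ∈ footprint Y).filter (fun Y => R.carriers.d Y ≠ 0), Real.exp (-(κ * R.carriers.d Y))
      ≤ K₀ (4 * 2 ^ 4) (2 * 4) * Real.exp (-(κ - 64 * Real.log 162)) :=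
  sum_filter_ne_zero_le (ineq126_level (R := R) k) (fun Y _ => torusTreeLen_dichotomy Y.2.1) hκ c

/-! ## §2 The numerals: `K₀(64, 8) = 162⁶⁴/81 ∈ (10¹³⁹, 10¹⁴⁰)`; the constant at `κ = 2κ₀` -/

/-- `K₀(64, 8) = e^{64·log 162}/81 = 162⁶⁴/81` (the tree's constant `B12TreeDecay.K₀ (4·2⁴) (2·4)` of `ineq126_level`, evaluated). [folklore] -/
theorem K₀_record_eq : K₀ (4 * 2 ^ 4) (2 * 4) = (162 : ℝ) ^ 64 / 81 := by
  have h64 : (4 * 2 ^ 4 : ℝ) * a₀ (2 * 4) = ((64 : ℕ) : ℝ) * Real.log 162 := by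
    simp only [a₀]
    push_cast
    norm_num
  have hexp : Real.exp (((64 : ℕ) : ℝ) * Real.log 162) = 162 ^ 64 := by
    rw [Real.exp_nat_mul, Real.exp_log (by norm_num)]
  simp only [K₀, kappa₀]
  rw [h64, hexp]
  push_cast
  norm_num

/-- `10¹³⁹ < K₀(64, 8) < 10¹⁴⁰` — the size of the constant the threshold-form producer `kpInflated_b13` carries into its smallness clause.
[folklore] -/
theorem K₀_record_bracket : (10 : ℝ) ^ 139 < K₀ (4 * 2 ^ 4) (2 * 4) ∧ K₀ (4 * 2 ^ 4) (2 * 4) < (10 : ℝ) ^ 140 := by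
  rw [K₀_record_eq]
  constructor
  · rw [lt_div_iff₀ (by norm_num : (0 : ℝ) < 81)]; norm_num
  · rw [div_lt_iff₀ (by norm_num : (0 : ℝ) < 81)]; norm_num

/-- The threshold rate itself: `64·log 162 < 326` (so `κ₀ = 64·log 162 ≈ 325.6`), from `162 < e⁵·(1 + 3/128)⁴ ≤ e^{163/32}`
(`Real.exp_one_gt_d9` and `Real.add_one_le_exp`). [folklore] -/
theorem kappa₀_record_lt : 64 * Real.log 162 < 326 := by
  have h1 : Real.log 162 < 163 / 32 := by
    rw [Real.log_lt_iff_lt_exp (by norm_num)]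
    have he : (2.7182818283 : ℝ) < Real.exp 1 := Real.exp_one_gt_d9
    have h5 : (2.7182818283 : ℝ) ^ 5 < Real.exp 5 := by
      have h := pow_lt_pow_left₀ he (by norm_num) (by norm_num : (5 : ℕ) ≠ 0)
      rwa [Real.exp_one_pow 5] at h
    have h4 : (1 + 3 / 128 : ℝ) ^ 4 ≤ Real.exp (3 / 32) := by
      have h3 : (1 + 3 / 128 : ℝ) ≤ Real.exp (3 / 128) := by
        have := Real.add_one_le_exp (3 / 128 : ℝ)
        linarith
      calc (1 + 3 / 128 : ℝ) ^ 4 ≤ Real.exp (3 / 128) ^ 4 := pow_le_pow_left₀ (by norm_num) h3 4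
        _ = Real.exp (3 / 32) := by rw [← Real.exp_nat_mul]; norm_num
    have hsplit : Real.exp (163 / 32) = Real.exp 5 * Real.exp (3 / 32) := by
      rw [← Real.exp_add]; norm_num
    rw [hsplit]
    calc (162 : ℝ) < (2.7182818283 : ℝ) ^ 5 * (1 + 3 / 128) ^ 4 := by norm_num
      _ ≤ Real.exp 5 * Real.exp (3 / 32) :=
          mul_le_mul h5.le h4 (by positivity) (Real.exp_pos _).le
  linarith

/-- At `κ = 2κ₀ = 128·log 162` the exponentially small part is EXACTLY `1/81`: `K₀(64,8)·e^{−(128·log 162 − 64·log 162)} = 1/81`, so the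
above-threshold constant there is `2²⁰ + 1/81`. [folklore] -/
theorem K₀_record_mul_exp_at_double : K₀ (4 * 2 ^ 4) (2 * 4) * Real.exp (-(128 * Real.log 162 - 64 * Real.log 162)) = 1 / 81 := by
  have h64 : (4 * 2 ^ 4 : ℝ) * a₀ (2 * 4) = 64 * Real.log 162 := by
    simp only [a₀]
    push_cast
    norm_num
  simp only [K₀, kappa₀]
  rw [h64, show -(128 * Real.log 162 - 64 * Real.log 162) = -(64 * Real.log 162) by ring, Real.exp_neg]
  have hpos : 0 < Real.exp (64 * Real.log 162) := Real.exp_pos _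
  field_simp
  push_cast
  norm_num

/-- The above-threshold (1.26) on the carriers of record at `κ = 128·log 162`: constant `2²⁰ + 1/81`. [cite: Balaban1988RG2Cluster, (1.26) p.8] -/
theorem ineq126_level_at_double (k : ℕ) :
    Ineq126 (R.domAt k) (fun X => footprint X) R.carriers.d (128 * Real.log 162) (2 ^ 20 + 1 / 81) := by
  have h := ineq126_level_above R k (κ := 128 * Real.log 162)
    (by have := Real.log_pos (by norm_num : (1 : ℝ) < 162); linarith)
  rwa [K₀_record_mul_exp_at_double] at h

/-! ## §3 The re-instantiated A1-KP producer on the carriers of record -/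

/-- **L03 ∕ A1-KP ON BAŁABAN's DOMAINS WITH THE ABOVE-THRESHOLD CONSTANT** — `B13DomainGeometryTR.kpInflated_b13` (t4-ne5-p2, consumed BY NAME on
the NE9 carriers-of-record face) re-instantiated through `ClusterRepKP.kpInflated_of_majorant` with (1.26) taken at the rate `64·log 162 + s′`
(§1): from a nonnegative majorant `m ≤ A·e^{−R·d}` on every `𝐃_k` (hypothesis SHAPE with locator [II] Lemma 3 (2.38) p. 20 — asserted
nowhere), the rate room `(64·log 162 + s′) + σ + 64τ ≤ R` and the smallness `(1+s)·A·e^{5σ+64τ}·(2²⁰ + K₀(64,8)·e^{−s′})·9 ≤ τ`.  At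
`s′ = 64·log 162` the constant is `2²⁰ + 1/81` (§2) in place of `K₀(64,8) ∈ (10¹³⁹, 10¹⁴⁰)`. [folklore] -/
theorem kpInflated_b13_above (ρA ρB : (ℕ → ℝ) → R.carriers.BgB → R.carriers.Dom → ℂ) {W : Set (ℕ → ℝ)}
    {m : (ℕ → ℝ) → R.carriers.BgB → R.carriers.Dom → ℝ} {A Rm τ σ s s' : ℝ}
    (hA : 0 ≤ A) (hτ : 0 ≤ τ) (hσ : 0 ≤ σ) (hs : 0 ≤ s) (hs' : 0 ≤ s')
    (hm0 : ∀ g U Z, 0 ≤ m g U Z)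
    (hm : ∀ g ∈ W, ∀ U (k : ℕ), ∀ Z ∈ R.domAt k, m g U Z ≤ A * Real.exp (-(Rm * R.carriers.d Z)))
    (hrate : (64 * Real.log 162 + s') + σ + τ * 64 ≤ Rm)
    (hsmall : (1 + s) * A * Real.exp (σ * 5 + τ * 64) * (2 ^ 20 + K₀ (4 * 2 ^ 4) (2 * 4) * Real.exp (-s')) * 9 ≤ τ) :
    KPInflated (clusterRep R ρA ρB) W m s (fun Z => τ * ((footprint Z).card : ℝ))
      (fun Z => σ * R.carriers.d Z + σ * 5) := by
  have h126 : ∀ k, Ineq126 (R.domAt k) (fun X => footprint X) R.carriers.d (64 * Real.log 162 + s')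
      (2 ^ 20 + K₀ (4 * 2 ^ 4) (2 * 4) * Real.exp (-s')) := by
    intro k
    have h := ineq126_level_above R k (κ := 64 * Real.log 162 + s') (by linarith)
    rwa [show -(64 * Real.log 162 + s' - 64 * Real.log 162) = -s' by ring] at h
  have hC : 0 ≤ (2 : ℝ) ^ 20 + K₀ (4 * 2 ^ 4) (2 * 4) * Real.exp (-s') :=
    add_nonneg (by positivity) (mul_nonneg (K₀_pos _ _).le (Real.exp_pos _).le)
  exact kpInflated_of_majorant (domainGeometry R) ρA ρB reach R.carriers.d loc_b13 reach_b13
    R.carriers.d_nonneg hA hC hτ hσ (mul_nonneg hσ (by norm_num)) hs hm0 hm h126 volBound_level hrate hsmall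

/-! ## §4 The A1-KP conjunct of the NE9 END on the carriers of record, from the repaired producer -/

variable {Pot : Type} [NormedAddCommGroup Pot] [NormedSpace ℂ Pot]

omit [NormedSpace ℂ Pot] in
/-- **A1-KP ON THE CARRIERS OF RECORD, PRINTED CURRENCY, ABOVE-THRESHOLD CONSTANT** (bookkeeping): `CarriersOfRecordFacesTR.twoPointKP_of_kpInflated`
(leaf-05-g2, p211088) fed BY NAME with `kpInflated_b13_above` at inflation `s = 1` and the majorant read through the creation step of the
polymer — `TwoPointKP` on `ClusterGeom.ofRep (clusterRep R ρA ρB)` from the two activity-level clauses (size, two-point in the table),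
`0 ≤ lip k`, the displayed (2.38)-SHAPED majorant `n (scale Z − 1) (g (scale Z − 1)) U Z ≤ A·e^{−R·d Z}` on every `𝐃_k`, the rate room
`(64·log 162 + s′) + σ + 64τ ≤ R` and the smallness `2·A·e^{5σ+64τ}·(2²⁰ + K₀(64,8)·e^{−s′})·9 ≤ τ`.  The (2.38)-shaped majorant itself stays
NODE O's; nothing about Bałaban's activities is discharged. [folklore] -/
theorem twoPointKP_record_above (ρA ρB : (ℕ → ℝ) → R.carriers.BgB → R.carriers.Dom → ℂ) {W : Set (ℕ → ℝ)}
    {act : ℕ → ℝ → R.carriers.BgB → Pot → (ClusterGeom.ofRep (clusterRep R ρA ρB)).P → ℂ} {𝒜 : ℕ → Set Pot}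
    {n : ℕ → ℝ → R.carriers.BgB → (ClusterGeom.ofRep (clusterRep R ρA ρB)).P → ℝ} {lip : ℕ → ℝ}
    {A Rm τ σ s' : ℝ} (hlip : ∀ k, 0 ≤ lip k)
    (hsize : ∀ g ∈ W, ∀ (k : ℕ) (U : R.carriers.BgB) (X : R.carriers.Dom), R.carriers.scale X = k + 1 → ∀ Q ∈ 𝒜 k,
      ∀ γ ∈ (ClusterGeom.ofRep (clusterRep R ρA ρB)).vol X, ‖act k (g k) U Q γ‖ ≤ n k (g k) U γ)
    (htwo : ∀ g ∈ W, ∀ (k : ℕ) (U : R.carriers.BgB) (X : R.carriers.Dom), R.carriers.scale X = k + 1 → ∀ Q ∈ 𝒜 k,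
      ∀ Q' ∈ 𝒜 k, ∀ γ ∈ (ClusterGeom.ofRep (clusterRep R ρA ρB)).vol X,
        ‖act k (g k) U Q γ - act k (g k) U Q' γ‖ ≤ lip k * ‖Q - Q'‖ * n k (g k) U γ)
    (hA : 0 ≤ A) (hτ : 0 ≤ τ) (hσ : 0 ≤ σ) (hs' : 0 ≤ s')
    (hn0 : ∀ (g : ℕ → ℝ) (U : R.carriers.BgB) (Z : R.carriers.Dom), 0 ≤ n (R.carriers.scale Z - 1) (g (R.carriers.scale Z - 1)) U Z)
    (hm : ∀ g ∈ W, ∀ (U : R.carriers.BgB) (k : ℕ), ∀ Z ∈ R.domAt k,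
      n (R.carriers.scale Z - 1) (g (R.carriers.scale Z - 1)) U Z ≤ A * Real.exp (-(Rm * R.carriers.d Z)))
    (hrate : (64 * Real.log 162 + s') + σ + τ * 64 ≤ Rm)
    (hsmall : (1 + 1) * A * Real.exp (σ * 5 + τ * 64) * (2 ^ 20 + K₀ (4 * 2 ^ 4) (2 * 4) * Real.exp (-s')) * 9 ≤ τ) :
    TwoPointKP (ClusterGeom.ofRep (clusterRep R ρA ρB)) W act 𝒜 n lip (fun Z => τ * ((footprint Z).card : ℝ))
      (fun Z => σ * R.carriers.d Z + σ * 5) :=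
  twoPointKP_of_kpInflated R ρA ρB hlip hsize htwo
    (kpInflated_b13_above R ρA ρB hA hτ hσ zero_le_one hs' hn0 hm hrate hsmall)

end Record

end Summit.QuantumFields.BalabanUV.T4Continuum.NE9RecordIneq126Above

end
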